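import Literature.NumberTheory.Rogawski1990.DepthZeroTransferHValuesTypeOne      -- ★ p846285 (FILE B): `χ_s` machinery (`isLocSmooth_indicator_ite_redMat`, `indicator_ite_redMat_conj`, `…_zero_add_one`, ROW-0 bridge)
import Literature.NumberTheory.Rogawski1990.DepthZeroTransferHValuesTypeTwo      -- ★-to-be FILE C: type-(2) level values any Haar
import HarnessLib

/-!
# T3′'s H-side values near the identity, TYPE (2): `Φ^st(γ_H, χ₀) = ν_H(K_H)·phiHtwo q (N−1)` and `Φ^st(γ_H, χ₁) = ν_H(K_H)·(phiHtwo q N − phiHtwo q (N−1))`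
# (`= ν_H(K_H)·q^N`) for HEAD v4's residual Jordan-stratum class functions `χ_s`

Topic `NumberTheory/Rogawski1990`; namespace `Literature.NumberTheory.Automorphic.UnitaryGroup`.  THEOREMS ONLY (no definition, no instance, no notation, no named fact,
no `sorry`).  Cell `pub/hodgecm-mathlib`, crux H413, road «S3-tree», brick **T6-2 ∕ O8c «H-values near 1», TYPE (2)** in the tokens of T3′ HEAD v4's clause
`depthZeroKappaTransfer_hyperspecial_typeTwo` (P-2 holder F0P2-p06 (g10); socket ★ p846003: «`Φ^st(χ₀) = ν_H(K_H)W₂(N−1)`, `Φ^st(χ₁) = ν_H(K_H)q^N`, `W₂ = phiHtwo q`,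
`W₂(N) − W₂(N−1) = q^N`»); END∕T6 holder F0P3a-p03 (g15).  HC_CM is proved only modulo the cell's 2 remaining named inputs (hLiu418, h413) until rung 0 closes; this file is
unconditional.

THE MATHEMATICS.  As in ★ FILE B, with the type-(2) level law ★ FILE C in place of the type-(1) law ★ FILE A: `χ₀` is the level-`ϖ_w` class function (ROW-0 bridge), so
`Φ^st(γ_H, χ₀) = ν_H(K_H)·phiHtwo q (N−1)`; every `K_H`-point of the (stable = ordinary) orbit of a DEEP `γ_H` — here deepness is read off the TRACE and DETERMINANT at `w`,
`tr g_w ≡ 2`, `det g_w ≡ 1 (mod 𝔪_w)`, with no eigenvalues needed (§1, valid for every torus type) — is residually unipotent, so `χ₀ + χ₁ = 1_{K_H}` on the orbit and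
`Φ^st(γ_H, χ₁) = Φ^st(1_{K_H}) − Φ^st(χ₀) = ν_H(K_H)·(phiHtwo q N − phiHtwo q (N−1))`.

* §1 `valuation_coeff_charpolyTwo_sub_sq_lt_one`, **`sq_redMat_sub_one_eq_zero_of_isLocalStablyConjH_of_trace_of_det`** (deep by trace∕det ⇒ residually unipotent on the
  stable orbit; torus-type-free).
* §2 HEADS **`stableOrbitalIntegralRel_chiZero_eq_mul_phiHtwo_of_not_exists_isRoot`**, **`stableOrbitalIntegralRel_chiOne_eq_mul_phiHtwo_sub_of_not_exists_isRoot`** — binders: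
  ★ FILE C's stub frame (`hunr νH mH hmH γH hreg [CompactSpace Z(γ₂)] h2 hint hirr N hN`) + `hN1 : 1 ≤ N` + deepness `htr : Valued.v (tr g_w − 2) < 1`,
  `hdet : Valued.v (det g_w − 1) < 1` + the decidability binder(s) of the `if` (pass `_`).

## References
* [Flicker1998UnitaryFL] Y. Z. Flicker, *Elementary proof of the fundamental lemma for a unitary group*, Canad. J. Math. 50 (1998), §6 p. 97.
* [Rogawski1990] J. D. Rogawski, *Automorphic Representations of Unitary Groups in Three Variables* (1990), §3.6 p. 31; §4.9 Prop. 4.9.1 (b) p. 55; §4.3 (4.3.1) p. 43.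
* [Kottwitz1986] R. E. Kottwitz, *Base change for unit elements of Hecke algebras*, Compositio Math. 60 (1986), §3.
-/

set_option autoImplicit false

noncomputable section

open MeasureTheory Measure Set Filter Topology NumberField IsDedekindDomain Matrix Polynomial ValuativeRel
open scoped ENNReal NNReal ValuativeRel Matrix MatrixGroups

namespace Literature.NumberTheory.Automorphic.UnitaryGroup

open Literature.NumberTheory.Rogawski1990 Literature.NumberTheory.Automorphic Literature.NumberTheory.Automorphic.IntegralReduction

/-! ## §1 Deep by trace and determinant ⇒ residually unipotent on the stable orbit (any torus type) -/

section Deep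

/-- **A deep quadratic is residually `(X − 1)²`**: if `v(t − 2), v(d − 1) < 1` then every coefficient of `(X² − tX + d) − (X − 1)²` has valuation `< 1`.
[cite: Kottwitz1986, §3] -/
theorem valuation_coeff_charpolyTwo_sub_sq_lt_one {K : Type*} [Field K] {Γ : Type*} [LinearOrderedCommGroupWithZero Γ] (vK : Valuation K Γ)
    {t d : K} (ht : vK (t - 2) < 1) (hd : vK (d - 1) < 1) (m : ℕ) :
    vK ((X ^ 2 - C t * X + C d - (X - 1) ^ 2).coeff m) < 1 := by
  have key : (X ^ 2 - C t * X + C d - (X - 1 : K[X]) ^ 2) = C (d - 1) + C (-(t - 2)) * X := by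
    simp only [map_sub, map_neg, map_one, map_ofNat]
    ring
  have hc1 : vK (-(t - 2)) < 1 := by rwa [Valuation.map_neg]
  rw [key]
  simp only [coeff_add, coeff_C, coeff_C_mul, coeff_X]
  rcases m with _ | _ | m
  · simpa using hd
  · simpa using hc1
  · simp

variable (L : Type) [Field L] [NumberField L] [IsCMField L] (v : HeightOneSpectrum (𝓞 ↥(maximalRealSubfield L)))
  (w : PlacesOver L v) (hw : IsCMField.complexConj L • w.1 = w.1)

set_option maxHeartbeats 400000 in
include hw in
/-- **DEEP BY TRACE∕DETERMINANT ⇒ RESIDUALLY UNIPOTENT ON THE WHOLE STABLE ORBIT** (every torus type): if `tr (γ_H.1)_w ≡ 2` and `det (γ_H.1)_w ≡ 1 (mod 𝔪_w)`, then every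
`K_H`-point `y b y⁻¹` of the stable orbit of `γ_H` has `(red((y b y⁻¹)_{2,w}) − 1)² = 0` (`χ_{b,w} = χ_{g,w} = X² − (tr)X + det ≡ (X − 1)²`; Cayley–Hamilton ★ A-p12
`redMat_sub_one_pow_eq_zero_of_deep`). [cite: Kottwitz1986, §3] [cite: Rogawski1990, §3.6 p. 31; §4.9 p. 54] -/
theorem sq_redMat_sub_one_eq_zero_of_isLocalStablyConjH_of_trace_of_det {γH : (cmDatum L 2 (Matrix.of fun i j : Fin 2 => if i.val + j.val + 1 = 2 then (1 : L) else 0)).Local v × (cmDatum L 1 (Matrix.of fun i j : Fin 1 => if i.val + j.val + 1 = 1 then (1 : L) else 0)).Local v}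
    (htr : Valued.v (((((γH).1.val : GL (Fin 2) (UnitaryGroup.LocalRing L v)).val.map (Pi.evalRingHom (fun w' : PlacesOver L v => w'.1.adicCompletion L) w))).trace - 2) < 1) (hdet : Valued.v (((((γH).1.val : GL (Fin 2) (UnitaryGroup.LocalRing L v)).val.map (Pi.evalRingHom (fun w' : PlacesOver L v => w'.1.adicCompletion L) w))).det - 1) < 1)
    {b : ((cmDatum L 2 (Matrix.of fun i j : Fin 2 => if i.val + j.val + 1 = 2 then (1 : L) else 0)).Local v × (cmDatum L 1 (Matrix.of fun i j : Fin 1 => if i.val + j.val + 1 = 1 then (1 : L) else 0)).Local v)} (hb : IsLocalStablyConjH L v γH b) (y : ((cmDatum L 2 (Matrix.of fun i j : Fin 2 => if i.val + j.val + 1 = 2 then (1 : L) else 0)).Local v × (cmDatum L 1 (Matrix.of fun i j : Fin 1 => if i.val + j.val + 1 = 1 then (1 : L) else 0)).Local v)) (hy : y * b * y⁻¹ ∈ (((cmLocalIntegralLevel L 2 (Matrix.of fun i j : Fin 2 => if i.val + j.val + 1 = 2 then (1 : L) else 0) v).prod (cmLocalIntegralLevel L 1 (Matrix.of fun i j : Fin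 1 => if i.val + j.val + 1 = 1 then (1 : L) else 0) v)) : Subgroup ((cmDatum L 2 (Matrix.of fun i j : Fin 2 => if i.val + j.val + 1 = 2 then (1 : L) else 0)).Local v × (cmDatum L 1 (Matrix.of fun i j : Fin 1 => if i.val + j.val + 1 = 1 then (1 : L) else 0)).Local v))) :
    (redMat (((y * b * y⁻¹).1.val : GL (Fin 2) (UnitaryGroup.LocalRing L v)).val.map (Pi.evalRingHom (fun w' : PlacesOver L v => w'.1.adicCompletion L) w)) - 1) ^ 2 = 0 := by
  -- `b.1` is `GL`-conjugate to `g`: same characteristic polynomial, read at `w`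
  have hcharb : ((((b).1.val : GL (Fin 2) (UnitaryGroup.LocalRing L v)).val.map (Pi.evalRingHom (fun w' : PlacesOver L v => w'.1.adicCompletion L) w))).charpoly = ((((γH).1.val : GL (Fin 2) (UnitaryGroup.LocalRing L v)).val.map (Pi.evalRingHom (fun w' : PlacesOver L v => w'.1.adicCompletion L) w))).charpoly := by
    rw [Matrix.charpoly_map, Matrix.charpoly_map, (charpoly_eq_of_isConj_units hb.1).symm]
  -- deepness at `w`
  have ht : ∀ m : ℕ, valuation (w.1.adicCompletion L) ((((((b).1.val : GL (Fin 2) (UnitaryGroup.LocalRing L v)).val.map (Pi.evalRingHom (fun w' : PlacesOver L v => w'.1.adicCompletion L) w))).charpoly - (Polynomial.X - 1) ^ 2).coeff m) < 1 := by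
    intro m
    rw [hcharb, Matrix.charpoly_fin_two]
    exact valuation_coeff_charpolyTwo_sub_sq_lt_one (valuation (w.1.adicCompletion L)) ((v_lt_one_iff_valuation_lt_one _).1 htr) ((v_lt_one_iff_valuation_lt_one _).1 hdet) m
  -- ★ A-p12: Cayley–Hamilton on the fixed `K₂`-conjugate `y₂ b₂ y₂⁻¹ = (y₂⁻¹)⁻¹ b₂ (y₂⁻¹)`
  have hy2 : y.1⁻¹⁻¹ * b.1 * y.1⁻¹ ∈ cmLocalIntegralLevel L 2 (Matrix.of fun i j : Fin 2 => if i.val + j.val + 1 = 2 then (1 : L) else 0) v := by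
    rw [inv_inv]; exact (Subgroup.mem_prod.1 hy).1
  have key := redMat_sub_one_pow_eq_zero_of_deep L 2 (Matrix.of fun i j : Fin 2 => if i.val + j.val + 1 = 2 then (1 : L) else 0) v w hw b.1 ht y.1⁻¹ hy2
  have hfst : (y * b * y⁻¹).1 = y.1⁻¹⁻¹ * b.1 * y.1⁻¹ := by rw [inv_inv]; rfl
  rw [hfst]
  exact key

end Deep

/-! ## §2 The two heads of T3′'s H-side, type (2) -/

section Heads

variable (L : Type) [Field L] [NumberField L] [IsCMField L] (v : HeightOneSpectrum (𝓞 ↥(maximalRealSubfield L)))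
  (w : PlacesOver L v) (hw : IsCMField.complexConj L • w.1 = w.1)
  [MeasurableSpace ((cmDatum L 2 (Matrix.of fun i j : Fin 2 => if i.val + j.val + 1 = 2 then (1 : L) else 0)).Local v × (cmDatum L 1 (Matrix.of fun i j : Fin 1 => if i.val + j.val + 1 = 1 then (1 : L) else 0)).Local v)] [BorelSpace ((cmDatum L 2 (Matrix.of fun i j : Fin 2 => if i.val + j.val + 1 = 2 then (1 : L) else 0)).Local v × (cmDatum L 1 (Matrix.of fun i j : Fin 1 => if i.val + j.val + 1 = 1 then (1 : L) else 0)).Local v)]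
  [∀ a : (cmDatum L 2 (Matrix.of fun i j : Fin 2 => if i.val + j.val + 1 = 2 then (1 : L) else 0)).Local v × (cmDatum L 1 (Matrix.of fun i j : Fin 1 => if i.val + j.val + 1 = 1 then (1 : L) else 0)).Local v, MeasurableSpace (((cmDatum L 2 (Matrix.of fun i j : Fin 2 => if i.val + j.val + 1 = 2 then (1 : L) else 0)).Local v × (cmDatum L 1 (Matrix.of fun i j : Fin 1 => if i.val + j.val + 1 = 1 then (1 : L) else 0)).Local v) ⧸ Subgroup.centralizer ({a} : Set ((cmDatum L 2 (Matrix.of fun i j : Fin 2 => if i.val + j.val + 1 = 2 then (1 : L) else 0)).Local v × (cmDatum L 1 (Matrix.of fun i j : Fin 1 => if i.val + j.val + 1 = 1 then (1 : L) else 0)).Local v)))]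
  [∀ a : (cmDatum L 2 (Matrix.of fun i j : Fin 2 => if i.val + j.val + 1 = 2 then (1 : L) else 0)).Local v × (cmDatum L 1 (Matrix.of fun i j : Fin 1 => if i.val + j.val + 1 = 1 then (1 : L) else 0)).Local v, BorelSpace (((cmDatum L 2 (Matrix.of fun i j : Fin 2 => if i.val + j.val + 1 = 2 then (1 : L) else 0)).Local v × (cmDatum L 1 (Matrix.of fun i j : Fin 1 => if i.val + j.val + 1 = 1 then (1 : L) else 0)).Local v) ⧸ Subgroup.centralizer ({a} : Set ((cmDatum L 2 (Matrix.of fun i j : Fin 2 => if i.val + j.val + 1 = 2 then (1 : L) else 0)).Local v × (cmDatum L 1 (Matrix.of fun i j : Fin 1 => if i.val + j.val + 1 = 1 then (1 : L) else 0)).Local v)))]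
  (νH : Measure ((cmDatum L 2 (Matrix.of fun i j : Fin 2 => if i.val + j.val + 1 = 2 then (1 : L) else 0)).Local v × (cmDatum L 1 (Matrix.of fun i j : Fin 1 => if i.val + j.val + 1 = 1 then (1 : L) else 0)).Local v)) [νH.IsHaarMeasure] [νH.IsMulRightInvariant]

set_option maxHeartbeats 400000 in
include hw in
/-- **O8c HEAD (χ₀), TYPE (2): `Φ^st(γ_H, χ₀) = ν_H(K_H) · phiHtwo q (N − 1)`** for HEAD v4's `χ₀ = 1_{K_H}·[(red h_{W,w} − 1)² = 0 ∧ rank(red h_{W,w} − 1) = 0]`, at a deep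
`G`-regular `γ_H` of type (2) in the stub frame of ★ FILE C (`hint h2 hirr hN`, `[CompactSpace Z(γ₂)]`) with `1 ≤ N` and `tr (γ₂)_w ≡ 2 (mod 𝔪_w)`: the ROW-0 bridge
(★ FILE B) identifies `χ₀` with the level-`ϖ_w` class function of ★ FILE C `stableOrbitalIntegralRel_level_eq_mul_phiHtwo_of_not_exists_isRoot` at `j = 1`.  Decidability
binder `χdec` (pass `_`). [cite: Flicker1998UnitaryFL, §6 p. 97] [cite: Rogawski1990, §4.9 Prop. 4.9.1 (b) p. 55; §4.3 (4.3.1) p. 43] [cite: Kottwitz1986, §3] -/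
theorem stableOrbitalIntegralRel_chiZero_eq_mul_phiHtwo_of_not_exists_isRoot (hunr : Algebra.IsUnramifiedIn (𝓞 L) v.asIdeal)
    {mH : OrbitalMeasureFamily ((cmDatum L 2 (Matrix.of fun i j : Fin 2 => if i.val + j.val + 1 = 2 then (1 : L) else 0)).Local v × (cmDatum L 1 (Matrix.of fun i j : Fin 1 => if i.val + j.val + 1 = 1 then (1 : L) else 0)).Local v)} (hmH : mH.IsCanonical (IsLocalGRegular L v) νH)
    {γH : (cmDatum L 2 (Matrix.of fun i j : Fin 2 => if i.val + j.val + 1 = 2 then (1 : L) else 0)).Local v × (cmDatum L 1 (Matrix.of fun i j : Fin 1 => if i.val + j.val + 1 = 1 then (1 : L) else 0)).Local v} (hreg : IsLocalGRegular L v γH)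
    [CompactSpace (Subgroup.centralizer ({γH.1} : Set ((cmDatum L 2 (Matrix.of fun i j : Fin 2 => if i.val + j.val + 1 = 2 then (1 : L) else 0)).Local v)))]
    (h2 : IsUnit (2 : 𝒪[(w.1.adicCompletion L)]))
    (hint : ∀ i : ℕ, ((((endoEmbLocal L v γH).val : GL (Fin 3) (LocalRing L v)).val.map (Pi.evalRingHom (fun w' : PlacesOver L v => w'.1.adicCompletion L) w)).charpoly.coeff i) ∈ 𝒪[(w.1.adicCompletion L)])
    (hirr : ¬ ∃ x : (w.1.adicCompletion L), (((((γH).1.val : GL (Fin 2) (UnitaryGroup.LocalRing L v)).val.map (Pi.evalRingHom (fun w' : PlacesOver L v => w'.1.adicCompletion L) w))).charpoly).IsRoot x)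
    (N : ℕ) (hN : Valued.v (((((γH).1.val : GL (Fin 2) (UnitaryGroup.LocalRing L v)).val.map (Pi.evalRingHom (fun w' : PlacesOver L v => w'.1.adicCompletion L) w))).trace ^ 2 - 4 * ((((γH).1.val : GL (Fin 2) (UnitaryGroup.LocalRing L v)).val.map (Pi.evalRingHom (fun w' : PlacesOver L v => w'.1.adicCompletion L) w))).det) = WithZero.exp (-((2 * N + 1 : ℕ) : ℤ)))
    (hN1 : 1 ≤ N) (htr : Valued.v (((((γH).1.val : GL (Fin 2) (UnitaryGroup.LocalRing L v)).val.map (Pi.evalRingHom (fun w' : PlacesOver L v => w'.1.adicCompletion L) w))).trace - 2) < 1)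
    (χdec : ∀ h : ((cmDatum L 2 (Matrix.of fun i j : Fin 2 => if i.val + j.val + 1 = 2 then (1 : L) else 0)).Local v × (cmDatum L 1 (Matrix.of fun i j : Fin 1 => if i.val + j.val + 1 = 1 then (1 : L) else 0)).Local v), Decidable ((redMat (((h).1.val : GL (Fin 2) (UnitaryGroup.LocalRing L v)).val.map (Pi.evalRingHom (fun w' : PlacesOver L v => w'.1.adicCompletion L) w)) - 1) ^ 2 = 0 ∧ (redMat (((h).1.val : GL (Fin 2) (UnitaryGroup.LocalRing L v)).val.map (Pi.evalRingHom (fun w' : PlacesOver L v => w'.1.adicCompletion L) w)) - 1).rank = 0)) :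
    stableOrbitalIntegralRel (IsLocalStablyConjH L v) mH (((((cmLocalIntegralLevel L 2 (Matrix.of fun i j : Fin 2 => if i.val + j.val + 1 = 2 then (1 : L) else 0) v).prod (cmLocalIntegralLevel L 1 (Matrix.of fun i j : Fin 1 => if i.val + j.val + 1 = 1 then (1 : L) else 0) v)) : Subgroup ((cmDatum L 2 (Matrix.of fun i j : Fin 2 => if i.val + j.val + 1 = 2 then (1 : L) else 0)).Local v × (cmDatum L 1 (Matrix.of fun i j : Fin 1 => if i.val + j.val + 1 = 1 then (1 : L) else 0)).Local v)) : Set ((cmDatum L 2 (Matrix.of fun i j : Fin 2 => if i.val + j.val + 1 = 2 then (1 : L) else 0)).Local v × (cmDatum L 1 (Matrix.of fun i j : Fin 1 => if i.val + j.val + 1 = 1 then (1 : L) else 0)).Local v)).indicator fun h => if (redMat (((h).1.val : GL (Fin 2) (UnitaryGroup.LocalRing L v)).val.map (Pi.evalRingHom (fun w' : PlacesOver L v => w'.1.adicCompletion L) w)) - 1) ^ 2 = 0 ∧ (redMat (((h).1.val : GL (Fin 2) (UnitaryGroup.LocalRing L v)).val.map (Pi.evalRingHom (fun w' : PlacesOver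 L v => w'.1.adicCompletion L) w)) - 1).rank = 0 then (1 : ℂ) else 0) γH =
      (νH.real ((((cmLocalIntegralLevel L 2 (Matrix.of fun i j : Fin 2 => if i.val + j.val + 1 = 2 then (1 : L) else 0) v).prod (cmLocalIntegralLevel L 1 (Matrix.of fun i j : Fin 1 => if i.val + j.val + 1 = 1 then (1 : L) else 0) v)) : Subgroup ((cmDatum L 2 (Matrix.of fun i j : Fin 2 => if i.val + j.val + 1 = 2 then (1 : L) else 0)).Local v × (cmDatum L 1 (Matrix.of fun i j : Fin 1 => if i.val + j.val + 1 = 1 then (1 : L) else 0)).Local v)) : Set ((cmDatum L 2 (Matrix.of fun i j : Fin 2 => if i.val + j.val + 1 = 2 then (1 : L) else 0)).Local v × (cmDatum L 1 (Matrix.of fun i j : Fin 1 => if i.val + j.val + 1 = 1 then (1 : L) else 0)).Local v)) : ℂ) * ((Flicker1998.phiHtwo (Ideal.absNorm v.asIdeal) (N - 1) : ℚ) : ℂ) := by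
  -- the uniformizer `ϖ_w`
  have hϖ1 := Liu2021.LemD1IndexedNonVacuityInertCofinite.valued_toPlace_uniformizer_of_isUnramifiedIn L v hunr w
  have hϖ := isUniformizingElement_of_v_eq hϖ1
  -- `|tr − 2| ≤ exp(−1)` from `< 1` (in `ℤᵐ⁰`: `x < 1 ↔ x ≤ exp (−1)`)
  have ht2 : Valued.v (((((γH).1.val : GL (Fin 2) (UnitaryGroup.LocalRing L v)).val.map (Pi.evalRingHom (fun w' : PlacesOver L v => w'.1.adicCompletion L) w))).trace - 2) ≤ WithZero.exp (-((1 : ℕ) : ℤ)) := by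
    have h := WithZero.lt_mul_exp_iff_le (x := Valued.v (((((γH).1.val : GL (Fin 2) (UnitaryGroup.LocalRing L v)).val.map (Pi.evalRingHom (fun w' : PlacesOver L v => w'.1.adicCompletion L) w))).trace - 2)) (y := WithZero.exp (-1 : ℤ)) WithZero.exp_ne_zero
    rw [← WithZero.exp_add, show (-1 : ℤ) + 1 = 0 by norm_num, WithZero.exp_zero] at h
    rw [Nat.cast_one]
    exact h.1 htr
  -- ★ FILE C at `j = 1`, with `χ₀` as the level-`ϖ_w` class function (ROW-0 bridge)
  refine stableOrbitalIntegralRel_level_eq_mul_phiHtwo_of_not_exists_isRoot L v w hw νH hunr hmH hreg h2 hint hirr N hN (j := 1) le_rfl hN1 ht2 _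
    (isLocSmooth_indicator_ite_redMat L v w hw 0 χdec).continuous Set.support_indicator_subset (indicator_ite_redMat_conj L v w hw 0 χdec) ?_ ?_
  · intro x hx hlev
    have hx' : x ∈ ((((cmLocalIntegralLevel L 2 (Matrix.of fun i j : Fin 2 => if i.val + j.val + 1 = 2 then (1 : L) else 0) v).prod (cmLocalIntegralLevel L 1 (Matrix.of fun i j : Fin 1 => if i.val + j.val + 1 = 1 then (1 : L) else 0) v)) : Subgroup ((cmDatum L 2 (Matrix.of fun i j : Fin 2 => if i.val + j.val + 1 = 2 then (1 : L) else 0)).Local v × (cmDatum L 1 (Matrix.of fun i j : Fin 1 => if i.val + j.val + 1 = 1 then (1 : L) else 0)).Local v)) : Set ((cmDatum L 2 (Matrix.of fun i j : Fin 2 => if i.val + j.val + 1 = 2 then (1 : L) else 0)).Local v × (cmDatum L 1 (Matrix.of fun i j : Fin 1 => if i.val + j.val + 1 = 1 then (1 : L) else 0)).Local v)) := hx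
    have hMW := coe_localNonsplitEquiv_apply L (Matrix.of fun i j : Fin 2 => if i.val + j.val + 1 = 2 then (1 : L) else 0) v w hw x.1
    have hb := sq_eq_zero_and_rank_eq_zero_iff_forall_valuation_le hϖ (localNonsplitEquiv_fst_mem_glInt L v w hw hx)
    rw [pow_one, hMW] at hlev
    rw [hMW] at hb
    exact (Set.indicator_of_mem hx' _).trans (if_pos (hb.2 hlev))
  · intro x hx hlev
    have hx' : x ∈ ((((cmLocalIntegralLevel L 2 (Matrix.of fun i j : Fin 2 => if i.val + j.val + 1 = 2 then (1 : L) else 0) v).prod (cmLocalIntegralLevel L 1 (Matrix.of fun i j : Fin 1 => if i.val + j.val + 1 = 1 then (1 : L) else 0) v)) : Subgroup ((cmDatum L 2 (Matrix.of fun i j : Fin 2 => if i.val + j.val + 1 = 2 then (1 : L) else 0)).Local v × (cmDatum L 1 (Matrix.of fun i j : Fin 1 => if i.val + j.val + 1 = 1 then (1 : L) else 0)).Local v)) : Set ((cmDatum L 2 (Matrix.of fun i j : Fin 2 => if i.val + j.val + 1 = 2 then (1 : L) else 0)).Local v × (cmDatum L 1 (Matrix.of fun i j : Fin 1 => if i.val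 + j.val + 1 = 1 then (1 : L) else 0)).Local v)) := hx
    have hMW := coe_localNonsplitEquiv_apply L (Matrix.of fun i j : Fin 2 => if i.val + j.val + 1 = 2 then (1 : L) else 0) v w hw x.1
    have hb := sq_eq_zero_and_rank_eq_zero_iff_forall_valuation_le hϖ (localNonsplitEquiv_fst_mem_glInt L v w hw hx)
    rw [pow_one, hMW] at hlev
    rw [hMW] at hb
    exact (Set.indicator_of_mem hx' _).trans (if_neg fun hP => hlev (hb.1 hP))

set_option maxHeartbeats 400000 in
include hw in
/-- **O8c HEAD (χ₁), TYPE (2): `Φ^st(γ_H, χ₁) = ν_H(K_H) · (phiHtwo q N − phiHtwo q (N − 1))`** (`= ν_H(K_H)·q^N`, ★ `phiHtwo_sub_phiHtwo_pred`) for HEAD v4's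
`χ₁ = 1_{K_H}·[(red h_{W,w} − 1)² = 0 ∧ rank(red h_{W,w} − 1) = 1]`, same frame as the `χ₀` head plus `det (γ₂)_w ≡ 1 (mod 𝔪_w)`: on the orbit every `K_H`-point is residually
unipotent (§1), `χ₀ + χ₁ = 1_{K_H}` there (★ FILE B), additivity (★ `localStableOrbitalIntegralH_add_of_isLocSmooth`), unit value ★ FILE C.  Decidability binders `χdec₀ χdec₁`.
[cite: Flicker1998UnitaryFL, §6 p. 97] [cite: Rogawski1990, §4.9 Prop. 4.9.1 (b) p. 55; §4.3 (4.3.1) p. 43] [cite: Kottwitz1986, §3] -/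
theorem stableOrbitalIntegralRel_chiOne_eq_mul_phiHtwo_sub_of_not_exists_isRoot (hunr : Algebra.IsUnramifiedIn (𝓞 L) v.asIdeal)
    {mH : OrbitalMeasureFamily ((cmDatum L 2 (Matrix.of fun i j : Fin 2 => if i.val + j.val + 1 = 2 then (1 : L) else 0)).Local v × (cmDatum L 1 (Matrix.of fun i j : Fin 1 => if i.val + j.val + 1 = 1 then (1 : L) else 0)).Local v)} (hmH : mH.IsCanonical (IsLocalGRegular L v) νH)
    {γH : (cmDatum L 2 (Matrix.of fun i j : Fin 2 => if i.val + j.val + 1 = 2 then (1 : L) else 0)).Local v × (cmDatum L 1 (Matrix.of fun i j : Fin 1 => if i.val + j.val + 1 = 1 then (1 : L) else 0)).Local v} (hreg : IsLocalGRegular L v γH)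
    [CompactSpace (Subgroup.centralizer ({γH.1} : Set ((cmDatum L 2 (Matrix.of fun i j : Fin 2 => if i.val + j.val + 1 = 2 then (1 : L) else 0)).Local v)))]
    (h2 : IsUnit (2 : 𝒪[(w.1.adicCompletion L)]))
    (hint : ∀ i : ℕ, ((((endoEmbLocal L v γH).val : GL (Fin 3) (LocalRing L v)).val.map (Pi.evalRingHom (fun w' : PlacesOver L v => w'.1.adicCompletion L) w)).charpoly.coeff i) ∈ 𝒪[(w.1.adicCompletion L)])
    (hirr : ¬ ∃ x : (w.1.adicCompletion L), (((((γH).1.val : GL (Fin 2) (UnitaryGroup.LocalRing L v)).val.map (Pi.evalRingHom (fun w' : PlacesOver L v => w'.1.adicCompletion L) w))).charpoly).IsRoot x)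
    (N : ℕ) (hN : Valued.v (((((γH).1.val : GL (Fin 2) (UnitaryGroup.LocalRing L v)).val.map (Pi.evalRingHom (fun w' : PlacesOver L v => w'.1.adicCompletion L) w))).trace ^ 2 - 4 * ((((γH).1.val : GL (Fin 2) (UnitaryGroup.LocalRing L v)).val.map (Pi.evalRingHom (fun w' : PlacesOver L v => w'.1.adicCompletion L) w))).det) = WithZero.exp (-((2 * N + 1 : ℕ) : ℤ)))
    (hN1 : 1 ≤ N) (htr : Valued.v (((((γH).1.val : GL (Fin 2) (UnitaryGroup.LocalRing L v)).val.map (Pi.evalRingHom (fun w' : PlacesOver L v => w'.1.adicCompletion L) w))).trace - 2) < 1) (hdet : Valued.v (((((γH).1.val : GL (Fin 2) (UnitaryGroup.LocalRing L v)).val.map (Pi.evalRingHom (fun w' : PlacesOver L v => w'.1.adicCompletion L) w))).det - 1) < 1)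
    (χdec₀ : ∀ h : ((cmDatum L 2 (Matrix.of fun i j : Fin 2 => if i.val + j.val + 1 = 2 then (1 : L) else 0)).Local v × (cmDatum L 1 (Matrix.of fun i j : Fin 1 => if i.val + j.val + 1 = 1 then (1 : L) else 0)).Local v), Decidable ((redMat (((h).1.val : GL (Fin 2) (UnitaryGroup.LocalRing L v)).val.map (Pi.evalRingHom (fun w' : PlacesOver L v => w'.1.adicCompletion L) w)) - 1) ^ 2 = 0 ∧ (redMat (((h).1.val : GL (Fin 2) (UnitaryGroup.LocalRing L v)).val.map (Pi.evalRingHom (fun w' : PlacesOver L v => w'.1.adicCompletion L) w)) - 1).rank = 0)) (χdec₁ : ∀ h : ((cmDatum L 2 (Matrix.of fun i j : Fin 2 => if i.val + j.val + 1 = 2 then (1 : L) else 0)).Local v × (cmDatum L 1 (Matrix.of fun i j : Fin 1 => if i.val + j.val + 1 = 1 then (1 : L) else 0)).Local v), Decidable ((redMat (((h).1.val : GL (Fin 2) (UnitaryGroup.LocalRing L v)).val.map (Pi.evalRingHom (fun w' : PlacesOver L v => w'.1.adicCompletion L) w)) - 1) ^ 2 = 0 ∧ (redMat (((h).1.val :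 GL (Fin 2) (UnitaryGroup.LocalRing L v)).val.map (Pi.evalRingHom (fun w' : PlacesOver L v => w'.1.adicCompletion L) w)) - 1).rank = 1)) :
    stableOrbitalIntegralRel (IsLocalStablyConjH L v) mH (((((cmLocalIntegralLevel L 2 (Matrix.of fun i j : Fin 2 => if i.val + j.val + 1 = 2 then (1 : L) else 0) v).prod (cmLocalIntegralLevel L 1 (Matrix.of fun i j : Fin 1 => if i.val + j.val + 1 = 1 then (1 : L) else 0) v)) : Subgroup ((cmDatum L 2 (Matrix.of fun i j : Fin 2 => if i.val + j.val + 1 = 2 then (1 : L) else 0)).Local v × (cmDatum L 1 (Matrix.of fun i j : Fin 1 => if i.val + j.val + 1 = 1 then (1 : L) else 0)).Local v)) : Set ((cmDatum L 2 (Matrix.of fun i j : Fin 2 => if i.val + j.val + 1 = 2 then (1 : L) else 0)).Local v × (cmDatum L 1 (Matrix.of fun i j : Fin 1 => if i.val + j.val + 1 = 1 then (1 : L) else 0)).Local v)).indicator fun h => if (redMat (((h).1.val : GL (Fin 2) (UnitaryGroup.LocalRing L v)).val.map (Pi.evalRingHom (fun w' : PlacesOver L v => w'.1.adicCompletion L)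 w)) - 1) ^ 2 = 0 ∧ (redMat (((h).1.val : GL (Fin 2) (UnitaryGroup.LocalRing L v)).val.map (Pi.evalRingHom (fun w' : PlacesOver L v => w'.1.adicCompletion L) w)) - 1).rank = 1 then (1 : ℂ) else 0) γH =
      (νH.real ((((cmLocalIntegralLevel L 2 (Matrix.of fun i j : Fin 2 => if i.val + j.val + 1 = 2 then (1 : L) else 0) v).prod (cmLocalIntegralLevel L 1 (Matrix.of fun i j : Fin 1 => if i.val + j.val + 1 = 1 then (1 : L) else 0) v)) : Subgroup ((cmDatum L 2 (Matrix.of fun i j : Fin 2 => if i.val + j.val + 1 = 2 then (1 : L) else 0)).Local v × (cmDatum L 1 (Matrix.of fun i j : Fin 1 => if i.val + j.val + 1 = 1 then (1 : L) else 0)).Local v)) : Set ((cmDatum L 2 (Matrix.of fun i j : Fin 2 => if i.val + j.val + 1 = 2 then (1 : L) else 0)).Local v × (cmDatum L 1 (Matrix.of fun i j : Fin 1 => if i.val + j.val + 1 = 1 then (1 : L) else 0)).Local v)) : ℂ) * ((Flicker1998.phiHtwo (Ideal.absNorm v.asIdeal) N - Flicker1998.phiHtwo (Ideal.absNorm v.asIdeal)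 (N - 1) : ℚ) : ℂ) := by
  have h0 := isLocSmooth_indicator_ite_redMat L v w hw 0 χdec₀
  have h1 := isLocSmooth_indicator_ite_redMat L v w hw 1 χdec₁
  -- `χ₀ + χ₁ = 1_{K_H}` on the stable orbit ⇒ same stable orbital integral as the unit
  have horbit : stableOrbitalIntegralRel (IsLocalStablyConjH L v) mH ((((((cmLocalIntegralLevel L 2 (Matrix.of fun i j : Fin 2 => if i.val + j.val + 1 = 2 then (1 : L) else 0) v).prod (cmLocalIntegralLevel L 1 (Matrix.of fun i j : Fin 1 => if i.val + j.val + 1 = 1 then (1 : L) else 0) v)) : Subgroup ((cmDatum L 2 (Matrix.of fun i j : Fin 2 => if i.val + j.val + 1 = 2 then (1 : L) else 0)).Local v × (cmDatum L 1 (Matrix.of fun i j : Fin 1 => if i.val + j.val + 1 = 1 then (1 : L) else 0)).Local v)) : Set ((cmDatum L 2 (Matrix.of fun i j : Fin 2 => if i.val + j.val + 1 = 2 then (1 : L) else 0)).Local v × (cmDatum L 1 (Matrix.of fun i j : Fin 1 => if i.val + j.val + 1 = 1 then (1 : L) else 0)).Local v)).indicator fun h => if (redMat (((h).1.val : GL (Fin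 2) (UnitaryGroup.LocalRing L v)).val.map (Pi.evalRingHom (fun w' : PlacesOver L v => w'.1.adicCompletion L) w)) - 1) ^ 2 = 0 ∧ (redMat (((h).1.val : GL (Fin 2) (UnitaryGroup.LocalRing L v)).val.map (Pi.evalRingHom (fun w' : PlacesOver L v => w'.1.adicCompletion L) w)) - 1).rank = 0 then (1 : ℂ) else 0) + (((((cmLocalIntegralLevel L 2 (Matrix.of fun i j : Fin 2 => if i.val + j.val + 1 = 2 then (1 : L) else 0) v).prod (cmLocalIntegralLevel L 1 (Matrix.of fun i j : Fin 1 => if i.val + j.val + 1 = 1 then (1 : L) else 0) v)) : Subgroup ((cmDatum L 2 (Matrix.of fun i j : Fin 2 => if i.val + j.val + 1 = 2 then (1 : L) else 0)).Local v × (cmDatum L 1 (Matrix.of fun i j : Fin 1 => if i.val + j.val + 1 = 1 then (1 : L) else 0)).Local v)) : Set ((cmDatum L 2 (Matrix.of fun i j : Fin 2 => if i.val + j.val + 1 = 2 then (1 : L) else 0)).Local v × (cmDatum L 1 (Matrix.of fun i j : Fin 1 => if i.val + j.val + 1 = 1 then (1 : L) else 0)).Local v)).indicator fun h => if (redMat (((h).1.val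 : GL (Fin 2) (UnitaryGroup.LocalRing L v)).val.map (Pi.evalRingHom (fun w' : PlacesOver L v => w'.1.adicCompletion L) w)) - 1) ^ 2 = 0 ∧ (redMat (((h).1.val : GL (Fin 2) (UnitaryGroup.LocalRing L v)).val.map (Pi.evalRingHom (fun w' : PlacesOver L v => w'.1.adicCompletion L) w)) - 1).rank = 1 then (1 : ℂ) else 0)) γH =
      stableOrbitalIntegralRel (IsLocalStablyConjH L v) mH (((((cmLocalIntegralLevel L 2 (Matrix.of fun i j : Fin 2 => if i.val + j.val + 1 = 2 then (1 : L) else 0) v).prod (cmLocalIntegralLevel L 1 (Matrix.of fun i j : Fin 1 => if i.val + j.val + 1 = 1 then (1 : L) else 0) v)) : Subgroup ((cmDatum L 2 (Matrix.of fun i j : Fin 2 => if i.val + j.val + 1 = 2 then (1 : L) else 0)).Local v × (cmDatum L 1 (Matrix.of fun i j : Fin 1 => if i.val + j.val + 1 = 1 then (1 : L) else 0)).Local v)) : Set ((cmDatum L 2 (Matrix.of fun i j : Fin 2 => if i.val + j.val + 1 = 2 then (1 : L) else 0)).Local v × (cmDatum L 1 (Matrix.of fun i j : Fin 1 => if i.val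 + j.val + 1 = 1 then (1 : L) else 0)).Local v)).indicator fun _ => (1 : ℂ)) γH :=
    stableOrbitalIntegralRel_congr_fun_of_eqOn mH {h : ((cmDatum L 2 (Matrix.of fun i j : Fin 2 => if i.val + j.val + 1 = 2 then (1 : L) else 0)).Local v × (cmDatum L 1 (Matrix.of fun i j : Fin 1 => if i.val + j.val + 1 = 1 then (1 : L) else 0)).Local v) | h ∈ (((cmLocalIntegralLevel L 2 (Matrix.of fun i j : Fin 2 => if i.val + j.val + 1 = 2 then (1 : L) else 0) v).prod (cmLocalIntegralLevel L 1 (Matrix.of fun i j : Fin 1 => if i.val + j.val + 1 = 1 then (1 : L) else 0) v)) : Subgroup ((cmDatum L 2 (Matrix.of fun i j : Fin 2 => if i.val + j.val + 1 = 2 then (1 : L) else 0)).Local v × (cmDatum L 1 (Matrix.of fun i j : Fin 1 => if i.val + j.val + 1 = 1 then (1 : L) else 0)).Local v)) → (redMat (((h).1.val : GL (Fin 2) (UnitaryGroup.LocalRing L v)).val.map (Pi.evalRingHom (fun w' : PlacesOver L v => w'.1.adicCompletion L) w)) - 1) ^ 2 = 0}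
      (fun b hb y => fun hy => sq_redMat_sub_one_eq_zero_of_isLocalStablyConjH_of_trace_of_det L v w hw htr hdet hb y hy)
      (fun h hh => (Pi.add_apply _ _ h).trans (indicator_ite_redMat_zero_add_one L v w χdec₀ χdec₁ hh))
  -- additivity and the two known values
  have hadd := localStableOrbitalIntegralH_add_of_isLocSmooth L v hmH.isAdmissibleOn γH hreg _ _ h0 h1
  have hunit := stableOrbitalIntegralRel_indicator_eq_mul_phiHtwo_of_not_exists_isRoot L v w hw νH hunr hmH hreg h2 hint hirr N hN
  have hzero := stableOrbitalIntegralRel_chiZero_eq_mul_phiHtwo_of_not_exists_isRoot L v w hw νH hunr hmH hreg h2 hint hirr N hN hN1 htr χdec₀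
  have hone : stableOrbitalIntegralRel (IsLocalStablyConjH L v) mH (((((cmLocalIntegralLevel L 2 (Matrix.of fun i j : Fin 2 => if i.val + j.val + 1 = 2 then (1 : L) else 0) v).prod (cmLocalIntegralLevel L 1 (Matrix.of fun i j : Fin 1 => if i.val + j.val + 1 = 1 then (1 : L) else 0) v)) : Subgroup ((cmDatum L 2 (Matrix.of fun i j : Fin 2 => if i.val + j.val + 1 = 2 then (1 : L) else 0)).Local v × (cmDatum L 1 (Matrix.of fun i j : Fin 1 => if i.val + j.val + 1 = 1 then (1 : L) else 0)).Local v)) : Set ((cmDatum L 2 (Matrix.of fun i j : Fin 2 => if i.val + j.val + 1 = 2 then (1 : L) else 0)).Local v × (cmDatum L 1 (Matrix.of fun i j : Fin 1 => if i.val + j.val + 1 = 1 then (1 : L) else 0)).Local v)).indicator fun h => if (redMat (((h).1.val : GL (Fin 2) (UnitaryGroup.LocalRing L v)).val.map (Pi.evalRingHom (fun w' : PlacesOver L v => w'.1.adicCompletion L) w)) - 1) ^ 2 = 0 ∧ (redMat (((h).1.val : GL (Fin 2) (UnitaryGroup.LocalRing L v)).val.map (Pi.evalRingHom (fun w' : PlacesOver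 L v => w'.1.adicCompletion L) w)) - 1).rank = 1 then (1 : ℂ) else 0) γH =
      stableOrbitalIntegralRel (IsLocalStablyConjH L v) mH ((((((cmLocalIntegralLevel L 2 (Matrix.of fun i j : Fin 2 => if i.val + j.val + 1 = 2 then (1 : L) else 0) v).prod (cmLocalIntegralLevel L 1 (Matrix.of fun i j : Fin 1 => if i.val + j.val + 1 = 1 then (1 : L) else 0) v)) : Subgroup ((cmDatum L 2 (Matrix.of fun i j : Fin 2 => if i.val + j.val + 1 = 2 then (1 : L) else 0)).Local v × (cmDatum L 1 (Matrix.of fun i j : Fin 1 => if i.val + j.val + 1 = 1 then (1 : L) else 0)).Local v)) : Set ((cmDatum L 2 (Matrix.of fun i j : Fin 2 => if i.val + j.val + 1 = 2 then (1 : L) else 0)).Local v × (cmDatum L 1 (Matrix.of fun i j : Fin 1 => if i.val + j.val + 1 = 1 then (1 : L) else 0)).Local v)).indicator fun h => if (redMat (((h).1.val : GL (Fin 2) (UnitaryGroup.LocalRing L v)).val.map (Pi.evalRingHom (fun w' : PlacesOver L v => w'.1.adicCompletion L) w)) - 1) ^ 2 = 0 ∧ (redMat (((h).1.val : GL (Fin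 2) (UnitaryGroup.LocalRing L v)).val.map (Pi.evalRingHom (fun w' : PlacesOver L v => w'.1.adicCompletion L) w)) - 1).rank = 0 then (1 : ℂ) else 0) + (((((cmLocalIntegralLevel L 2 (Matrix.of fun i j : Fin 2 => if i.val + j.val + 1 = 2 then (1 : L) else 0) v).prod (cmLocalIntegralLevel L 1 (Matrix.of fun i j : Fin 1 => if i.val + j.val + 1 = 1 then (1 : L) else 0) v)) : Subgroup ((cmDatum L 2 (Matrix.of fun i j : Fin 2 => if i.val + j.val + 1 = 2 then (1 : L) else 0)).Local v × (cmDatum L 1 (Matrix.of fun i j : Fin 1 => if i.val + j.val + 1 = 1 then (1 : L) else 0)).Local v)) : Set ((cmDatum L 2 (Matrix.of fun i j : Fin 2 => if i.val + j.val + 1 = 2 then (1 : L) else 0)).Local v × (cmDatum L 1 (Matrix.of fun i j : Fin 1 => if i.val + j.val + 1 = 1 then (1 : L) else 0)).Local v)).indicator fun h => if (redMat (((h).1.val : GL (Fin 2) (UnitaryGroup.LocalRing L v)).val.map (Pi.evalRingHom (fun w' : PlacesOver L v => w'.1.adicCompletion L) w)) - 1) ^ 2 = 0 ∧ (redMat (((h).1.val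 : GL (Fin 2) (UnitaryGroup.LocalRing L v)).val.map (Pi.evalRingHom (fun w' : PlacesOver L v => w'.1.adicCompletion L) w)) - 1).rank = 1 then (1 : ℂ) else 0)) γH - stableOrbitalIntegralRel (IsLocalStablyConjH L v) mH (((((cmLocalIntegralLevel L 2 (Matrix.of fun i j : Fin 2 => if i.val + j.val + 1 = 2 then (1 : L) else 0) v).prod (cmLocalIntegralLevel L 1 (Matrix.of fun i j : Fin 1 => if i.val + j.val + 1 = 1 then (1 : L) else 0) v)) : Subgroup ((cmDatum L 2 (Matrix.of fun i j : Fin 2 => if i.val + j.val + 1 = 2 then (1 : L) else 0)).Local v × (cmDatum L 1 (Matrix.of fun i j : Fin 1 => if i.val + j.val + 1 = 1 then (1 : L) else 0)).Local v)) : Set ((cmDatum L 2 (Matrix.of fun i j : Fin 2 => if i.val + j.val + 1 = 2 then (1 : L) else 0)).Local v × (cmDatum L 1 (Matrix.of fun i j : Fin 1 => if i.val + j.val + 1 = 1 then (1 : L) else 0)).Local v)).indicator fun h => if (redMat (((h).1.val : GL (Fin 2) (UnitaryGroup.LocalRing L v)).val.map (Pi.evalRingHom (fun w' : PlacesOver L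 v => w'.1.adicCompletion L) w)) - 1) ^ 2 = 0 ∧ (redMat (((h).1.val : GL (Fin 2) (UnitaryGroup.LocalRing L v)).val.map (Pi.evalRingHom (fun w' : PlacesOver L v => w'.1.adicCompletion L) w)) - 1).rank = 0 then (1 : ℂ) else 0) γH := by
    rw [hadd]; ring
  rw [hone, horbit, hunit, hzero]
  push_cast
  ring

end Heads

end Literature.NumberTheory.Automorphic.UnitaryGroup

end
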